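import Literature.IUT.HodgeArakelov.EtaleThetaDataOfSettingRootHypOfCor28iStableOfDelta
import Literature.IUT.HodgeArakelov.ThetaEnvDataRecordAutSaturatedOfHgalois

/-!
# [IUTchII] Prop 3.4 (i) at the GENUINE data — node IUTchII:Prop3.4(i), binder (P3) REDUCED TO (HGAL) ALONE along the three
# ROUTE-2 statements of record that still carried `hgal = (HGAL) ∧ (HCYC)`: COMPANION-FREE (`…_ofCor28iIntrinsic`), v2
# INNER-ADJUSTED (`…_ofCor28i_innerAdjust`) and STABLE-OF-Δ (`…_ofCor28iStableOfDelta`) — row «INTRINSIC-HGALOIS-TWIN»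

S. Mochizuki, *Inter-universal Teichmüller theory II*, kurims manuscript (Dec. 2020): Prop 3.4 (i) pp. 91–92
[cite: Mochizuki2012, Prop 3.4 (i) p.91]; Cor 1.11 (b) p. 49; Prop 1.4 p. 27.  Claim key DISPUTED (D-0012).  Refereed inputs BY
NAME ([EtTh] = S. Mochizuki, Publ. RIMS **45** (2009)): Cor. 2.18 (i) p. 60 (F-0620 `RigidData.Cor218_i`), Prop. 2.4 p. 38 (F-0609
`TemperedCoverData.Prop24`), Cor. 2.8 (i) p. 42 (F-0640 `ThetaOrbitData.Cor28_i`) [cite: MochizukiEtTh2009, Cor 2.8(i) p.42], §1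
pp. 12–13 (the class-R origin clauses `IsEtThOrigin`, `hYcl` = G-w4d021-2, `IsTateOrigin` — interface root data, never asserted);
[AbsTopIII] Cor. 1.10 pp. 41–44 = (HGAL) «every topological automorphism of `Π^tp_{X̲̲}` lies over `Inn(τ)|_{G_K}`» — the ONE remaining
FACT-class input of binder (P3) (GAP-LEDGER G-w5d169-3; cell ruling C-R25).  abc-iut cell, layer L6, WAVE-5 seat abc-iut-w5-d169
(gen 6; holder lineage of node IUTchII:Prop3.4(i), `plan/L6/SUBDAG-IUTchII-Prop-31-33-34.md`); row «INTRINSIC-HGALOIS-TWIN» (named by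
abc-iut-w4-d041 gen 8 with first refusal to this lineage; sibling of their `ThetaEnvDataRecordAutSaturatedOfCoreOfHgalois`, p455639,
which serves the Route-1 / generic statements).

PROOF-ONLY KNIT (no definition, no `Prop`-valued fact, nothing restated).  The cyclotomic half (HCYC) of the print-currency binder
`hgal = (HGAL) ∧ (HCYC)` is a THEOREM (`EtaleThetaDataOfSetting.hcyc_of_hgal` / `hgal_of_hgalois`, this lineage gen 5, p450689);
gen 5 knitted it into ROUTE 2 v1 only (`…_ofCor28i_ofHgalois`, p451049, which keeps `hcharY`).  Here the same substitution
`hgal := hgal_of_hgalois … hHGAL` for the three other ROUTE-2 consumers, with the F-2633-shaped binder `hcharY`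
(`PiYddCharacteristic C`) DISCHARGED from F-0620 by abc-iut-w4-d013's `piYddCharacteristic_of_cor218_i` wherever it was still free:
* **`EtaleLevels.prop34i_multiradiallyDefined_saturated_ofCor28iIntrinsic_ofHgalois`** (+ `exists_coeff_…`) — abc-iut-w6-d051's
  COMPANION-FREE statement (p447525).  Residual BY NAME exactly: F-0620 · F-0609 · F-0640 · `hq` (R3) · `hO'` · `hYcl` · `hT` ·
  `hιe` · `hstd` · `hDtau'` · `hInd` · **`hHGAL`** · the standing record/tower inputs — the by-name-weakest binder list among the
  landed forms of the node statement (no `hcharY`, no `hιX`, no `hΔ`, no theta companion, no (HCYC)).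
* **`EtaleLevels.prop34i_multiradiallyDefined_saturated_ofCor28i_innerAdjust_ofHgalois`** (+ `exists_coeff_…`, new here) — this
  lineage's ROUTE 2 v2 statement (p444361 v2, abc-iut-w5-d118's `rootHyp_of_cor28_i_innerAdjust`, the satisfiable inner-adjusted `Dtau`
  clause per FINDING F-w5d118g5-1).  Residual BY NAME: F-0620 · F-0609 · F-0640 · `hq` · `hO'` · `hYcl` · `hT` · `hιe`/`hιX` · `hΔ` ·
  `hstd` · `hDtau'` · **`hHGAL`**.
* **`EtaleLevels.prop34i_multiradiallyDefined_saturated_ofCor28iStableOfDelta_ofHgalois`** (+ `exists_coeff_…`) — abc-iut-w6-d002's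
  STABLE-OF-Δ statement (p451697: `hInd` discharged from `hιX` + `hΔ`).  Residual BY NAME: as the v2 row.
Nothing here asserts anything of [IUTchII] or [EtTh]; no side taken on [IUTchIII] Cor 3.12; typed ≠ proved for the binders.
-/

noncomputable section

open Topology

namespace Literature.IUT.HodgeArakelov

open Literature.AnabelianGeometry.EtaleTheta Literature.AnabelianGeometry.SemiGraphs
open CohomologySystemOfContH1 EtaleThetaDataOfSetting TemperedThetaMonoids ThetaCovers
open scoped Literature.AnabelianGeometry.EtaleTheta

namespace EtaleLevels

universe u

variable {p : ℕ} [Fact p.Prime] {D : Literature.AnabelianGeometry.EtaleTheta.ThetaSetting p}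
  {E : D.EtaleThetaData} {l : ℕ} (C : E.DoubleUnderline l) (hC : D.Compat) (hS : D.Sec2Hyps)
  (hl : l.Prime) (hp2 : p ≠ 2) (hpl : p ≠ l) (hζ : ∃ ζ : D.K, IsPrimitiveRoot ζ (4 * l))
  (mods : ∀ M : ℕ+, D.CyclotomeMod l M)
  (f : contCocycles D.toTheta D.DeltaTheta C.GtpYdduu) (hf : f ∈ C.rootCocycles hC)
  (hmods : ∀ (M M' : ℕ+) (h : (M : ℕ) ∣ (M' : ℕ)) (x : D.lDeltaTheta l),
    MuN.red p M M' h ((mods M').red x) = (mods M).red x)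
  (h15 : Literature.AnabelianGeometry.EtaleTheta.ThetaSetting.Prop15iii E hC) (L : C.CuspLabels)
  (hZ : ∀ M : ℕ+, Nonempty (ModelCyclotomes.lDeltaQuot (C.rigidData (mods M) hC hS h15 L) ≃*
    Literature.IUT.HodgeTheaters.ZHat))
  (hlim : Function.Bijective (rigidLimHom C hC hS hl hp2 hpl hζ mods f hf hmods h15 L hZ))
  [(EtaleThetaDataOfSetting.PiYdd C).Normal]
  (hq : IsQuotientMap D.toTheta) {N : ℕ+} (μ : D.CyclotomeMod l N)
  (R : RigidData.{0} N l) (hR : R = C.rigidData μ hC hS h15 L) (h218i : R.Cor218_i)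
  -- ROUTE 2 inputs along the orbit embedding `ε` (abc-iut-w5-d118 / abc-iut-w6-d051 / abc-iut-w6-d002 suppliers)
  {T : TemperedCoverData.{u} l} (ε : C.OrbitEmbedding T)
  (hιe : IsOpenEmbedding ε.ι) (h24 : T.Prop24) (hstd : (ThetaOrbitData.ofEmbedding ε hC hS).IsStandard)
  (h28 : (ThetaOrbitData.ofEmbedding ε hC hS).Cor28_i)
  (hDtau' : ∀ Γ : T.Gtp ≃ₜ* T.Gtp, (∀ S ∈ T.tower, S.map Γ.toMulEquiv.toMonoidHom = S) →
    ∃ u ∈ C.Huu, ∀ Dt ∈ (ThetaOrbitData.ofEmbedding ε hC hS).Dtau,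
      Dt.map (Γ.trans (ThetaOrbitData.innerAutTop (ε.ι u))).toMulEquiv.toMonoidHom ∈
        (ThetaOrbitData.ofEmbedding ε hC hS).Dtau)
  -- companion-free: `hInd`
  (hInd : ∀ Γ : T.Gtp ≃ₜ* T.Gtp, (∀ S ∈ T.tower, S.map Γ.toMulEquiv.toMonoidHom = S) →
    ∃ ΓΘ : (ThetaOrbitData.ofEmbedding ε hC hS).DeltaTheta ≃* (ThetaOrbitData.ofEmbedding ε hC hS).DeltaTheta,
      (ThetaOrbitData.ofEmbedding ε hC hS).InducesOnTheta Γ ΓΘ)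
  -- v2 / stable-of-Δ: `hιX` + `hΔ`
  (hιX : ε.ι.range = T.tp T.PiX)
  (hΔ : ∀ γ : D.PiTemp ≃ₜ* D.PiTemp, D.DeltaTemp.map γ.toMulEquiv.toMonoidHom = D.DeltaTemp)
  -- index / constants / origin
  (ι₀ : (Pi C) ≃ₜ* (Pi C))
  {Es : Set ℕ+} (τw : D.CyclotomeTower l Es)
  (O : Submonoid (PadicAlgCl p)ˣ)
  (hO : ∀ (σ : GQp p) (u : (PadicAlgCl p)ˣ), u ∈ O → Units.map (σ : PadicAlgCl p →* PadicAlgCl p) u ∈ O)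
  (hO' : D.IsEtThOrigin)
  -- the class-R §1 origin clauses under which (HCYC) ⟸ (HGAL) (`EtaleThetaDataOfSetting.hcyc_of_hgal`)
  (hYcl : (D.DtpY.map D.toHat.toMonoidHom).topologicalClosure ≤
    D.DtpY.map D.toHat.toMonoidHom ⊔ (⁅⁅D.DeltaHat, D.DeltaHat⁆, D.DeltaHat⁆).topologicalClosure)
  (hT : D.IsTateOrigin)
  -- (P3) = (HGAL) ALONE: every topological automorphism of `Π^tp_{X̲̲}` lies over `Inn(τ)|_{G_K}` ([AbsTopIII] Cor 1.10)
  (hHGAL : ∀ α : (Pi C) ≃ₜ* (Pi C), ∃ τ : GQp p, ∀ x : Pi C, aug C (α x) = τ * aug C x * τ⁻¹)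

/-! ### Route 2, companion-free (`hInd`): (P3) := (HGAL) alone -/

/-- **[IUTchII] Prop 3.4 (i) — MULTIRADIALITY OF SPLIT THETA MONOIDS AT THE GENUINE FUNCTOR, Route 2 companion-free,
(P3) = (HGAL) alone**: (P1) := {F-0620, `hq`} (`hcharY` derived from F-0620); (P2) none (saturated index set); (P3) := `hHGAL`
([AbsTopIII] Cor 1.10) + class-R clauses `hYcl`, `hT` — the cyclotomic half (HCYC) PROVED (`hcyc_of_hgal`); (P4) := abc-iut-w6-d051's
`rootHyp_of_cor28_i_intrinsic_innerAdjust` (F-0609 `h24`, F-0640 `h28`, `hstd`, `hDtau'`, `hInd`, `hιe`).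
[cite: Mochizuki2012, Prop 3.4 (i) p.92] -/
theorem prop34i_multiradiallyDefined_saturated_ofCor28iIntrinsic_ofHgalois
    (c : CyclotomeCoefficients (phi C) (D.lDeltaTheta l) (PadicAlgCl p)ˣ)
    (hlev : ∀ (ζ : cyclotome (PadicAlgCl p)ˣ) (M : ℕ+),
      (((τw.modAll M).red (c.hom ζ) : MuN p M) : (PadicAlgCl p)ˣ) = (ζ : ℕ+ → (PadicAlgCl p)ˣ) M)
    {η : (C.thetaEnvData μ hC hS).PiYdd → MuN p N} (hη : η ∈ (C.thetaEnvData μ hC hS).thetaCocycles)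
    (Γ : Type) [Group Γ] :
    haveI := hC.GtpYdd_normal
    ((ex18iii (ThetaSetting.ofDoubleUnderline C μ hC hS hl hp2 hpl hζ hη) Γ).toDagger
      (TemperedThetaMonoids.prop34iRadialFunctor
        (thetaEnvTransportS C hC hS hl hp2 hpl hζ mods f hf hmods h15 L hZ
          (piYddCharacteristic_of_cor218_i C μ hC hS h15 L R hR h218i) hlim hq μ R hR h218i
          (h1LimKummerOn (phi C) (D.lDeltaTheta l) (PiYdd C) c (isOpen_stabilizer_units C)
            (finiteIndex_stabilizer_units C) O) ι₀
          (map_mrange_h1LimKummerOn_eq_of_galois C hq μ τw c hlev O hO hC hS h15 L R hR h218i hO'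
            (hgal_of_hgalois C hO' hYcl hT hS hq μ hC h15 L R hR h218i τw hHGAL))
          (image_toLim_theta_thetaEnvData_of_rootHyp C hC hS hl hp2 hpl hζ mods f hf hmods h15 L hZ
            (piYddCharacteristic_of_cor218_i C μ hC hS h15 L R hR h218i) hlim hq μ R hR h218i
            (fun α => rootHyp_of_cor28_i_intrinsic_innerAdjust C hq α ε μ hC hS h15 L R hR h218i hιe h24 hstd h28
              hDtau' hInd))
          (image_thetaInfty_thetaEnvData_of_rootHyp C hC hS hl hp2 hpl hζ mods f hf hmods h15 L hZ
            (piYddCharacteristic_of_cor218_i C μ hC hS h15 L R hR h218i) hlim hq μ R hR h218i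
            (fun α => rootHyp_of_cor28_i_intrinsic_innerAdjust C hq α ε μ hC hS h15 L R hR h218i hιe h24 hstd h28
              hDtau' hInd)) hη)
        Γ)).IsMultiradiallyDefined := by
  haveI := hC.GtpYdd_normal
  exact prop34i_multiradiallyDefined_saturated_ofCor28iIntrinsic C hC hS hl hp2 hpl hζ mods f hf hmods h15 L hZ hlim hq μ R
    hR h218i ε hιe h24 hstd h28 hDtau' hInd ι₀ τw O hO hO'
    (hgal_of_hgalois C hO' hYcl hT hS hq μ hC h15 L R hR h218i τw hHGAL) c hlev hη Γ

/-- **The same with the coefficient datum DISCHARGED** (`exists_cyclotomeCoefficients_of_cyclotomeTower` under `hO'` + `hΔc`):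
residual BY NAME {F-0620, F-0609, F-0640, `hq`, `hO'`, `hYcl`, `hT`, `hΔc`, `hιe`, `hstd`, `hDtau'`, `hInd`, `hHGAL`} plus the
standing record/tower inputs (no `hcharY`, no `hιX`, no `hΔ`, no theta companion, no (HCYC)). [cite: Mochizuki2012, Prop 3.4 (i) p.92] -/
theorem exists_coeff_prop34i_multiradiallyDefined_saturated_ofCor28iIntrinsic_ofHgalois
    (hΔc : IsCompact (D.DeltaTheta : Set D.GtpTheta))
    {η : (C.thetaEnvData μ hC hS).PiYdd → MuN p N} (hη : η ∈ (C.thetaEnvData μ hC hS).thetaCocycles)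
    (Γ : Type) [Group Γ] :
    haveI := hC.GtpYdd_normal
    ∃ (c : CyclotomeCoefficients (phi C) (D.lDeltaTheta l) (PadicAlgCl p)ˣ)
      (hlev : ∀ (ζ : cyclotome (PadicAlgCl p)ˣ) (M : ℕ+),
        (((τw.modAll M).red (c.hom ζ) : MuN p M) : (PadicAlgCl p)ˣ) = (ζ : ℕ+ → (PadicAlgCl p)ˣ) M),
      Function.Bijective c.hom ∧
      ((ex18iii (ThetaSetting.ofDoubleUnderline C μ hC hS hl hp2 hpl hζ hη) Γ).toDagger
        (TemperedThetaMonoids.prop34iRadialFunctor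
          (thetaEnvTransportS C hC hS hl hp2 hpl hζ mods f hf hmods h15 L hZ
            (piYddCharacteristic_of_cor218_i C μ hC hS h15 L R hR h218i) hlim hq μ R hR h218i
            (h1LimKummerOn (phi C) (D.lDeltaTheta l) (PiYdd C) c (isOpen_stabilizer_units C)
              (finiteIndex_stabilizer_units C) O) ι₀
            (map_mrange_h1LimKummerOn_eq_of_galois C hq μ τw c hlev O hO hC hS h15 L R hR h218i hO'
              (hgal_of_hgalois C hO' hYcl hT hS hq μ hC h15 L R hR h218i τw hHGAL))
            (image_toLim_theta_thetaEnvData_of_rootHyp C hC hS hl hp2 hpl hζ mods f hf hmods h15 L hZ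
              (piYddCharacteristic_of_cor218_i C μ hC hS h15 L R hR h218i) hlim hq μ R hR h218i
              (fun α => rootHyp_of_cor28_i_intrinsic_innerAdjust C hq α ε μ hC hS h15 L R hR h218i hιe h24 hstd h28
                hDtau' hInd))
            (image_thetaInfty_thetaEnvData_of_rootHyp C hC hS hl hp2 hpl hζ mods f hf hmods h15 L hZ
              (piYddCharacteristic_of_cor218_i C μ hC hS h15 L R hR h218i) hlim hq μ R hR h218i
              (fun α => rootHyp_of_cor28_i_intrinsic_innerAdjust C hq α ε μ hC hS h15 L R hR h218i hιe h24 hstd h28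
                hDtau' hInd)) hη)
          Γ)).IsMultiradiallyDefined := by
  haveI := hC.GtpYdd_normal
  exact exists_coeff_prop34i_multiradiallyDefined_saturated_ofCor28iIntrinsic C hC hS hl hp2 hpl hζ mods f hf hmods h15 L hZ
    hlim hq μ R hR h218i ε hιe h24 hstd h28 hDtau' hInd ι₀ τw O hO hO'
    (hgal_of_hgalois C hO' hYcl hT hS hq μ hC h15 L R hR h218i τw hHGAL) hΔc hη Γ

/-! ### Route 2, v2 inner-adjusted (`hιX`, `hΔ`, `hDtau'`): `hcharY` from F-0620; (P3) := (HGAL) alone -/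

/-- **[IUTchII] Prop 3.4 (i) — MULTIRADIALITY OF SPLIT THETA MONOIDS AT THE GENUINE FUNCTOR, Route 2 v2 (inner-adjusted `Dtau`
clause), (P3) = (HGAL) alone**: this lineage's `prop34i_multiradiallyDefined_saturated_ofCor28i_innerAdjust` (p444361 v2) with
`hcharY := piYddCharacteristic_of_cor218_i …` (F-0620) and `hgal := hgal_of_hgalois … hHGAL`; (P4) := abc-iut-w5-d118's
`rootHyp_of_cor28_i_innerAdjust` (F-0609 `h24`, F-0640 `h28`, `hstd`, `hDtau'`, `hιe`, `hιX`, `hΔ`).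
[cite: Mochizuki2012, Prop 3.4 (i) p.92] -/
theorem prop34i_multiradiallyDefined_saturated_ofCor28i_innerAdjust_ofHgalois
    (c : CyclotomeCoefficients (phi C) (D.lDeltaTheta l) (PadicAlgCl p)ˣ)
    (hlev : ∀ (ζ : cyclotome (PadicAlgCl p)ˣ) (M : ℕ+),
      (((τw.modAll M).red (c.hom ζ) : MuN p M) : (PadicAlgCl p)ˣ) = (ζ : ℕ+ → (PadicAlgCl p)ˣ) M)
    {η : (C.thetaEnvData μ hC hS).PiYdd → MuN p N} (hη : η ∈ (C.thetaEnvData μ hC hS).thetaCocycles)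
    (Γ : Type) [Group Γ] :
    haveI := hC.GtpYdd_normal
    ((ex18iii (ThetaSetting.ofDoubleUnderline C μ hC hS hl hp2 hpl hζ hη) Γ).toDagger
      (TemperedThetaMonoids.prop34iRadialFunctor
        (thetaEnvTransportS C hC hS hl hp2 hpl hζ mods f hf hmods h15 L hZ
          (piYddCharacteristic_of_cor218_i C μ hC hS h15 L R hR h218i) hlim hq μ R hR h218i
          (h1LimKummerOn (phi C) (D.lDeltaTheta l) (PiYdd C) c (isOpen_stabilizer_units C)
            (finiteIndex_stabilizer_units C) O) ι₀
          (map_mrange_h1LimKummerOn_eq_of_galois C hq μ τw c hlev O hO hC hS h15 L R hR h218i hO'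
            (hgal_of_hgalois C hO' hYcl hT hS hq μ hC h15 L R hR h218i τw hHGAL))
          (image_toLim_theta_thetaEnvData_of_rootHyp C hC hS hl hp2 hpl hζ mods f hf hmods h15 L hZ
            (piYddCharacteristic_of_cor218_i C μ hC hS h15 L R hR h218i) hlim hq μ R hR h218i
            (rootHyp_of_cor28_i_innerAdjust C ε hq μ hC hS h15 L R hR h218i hιe hιX hΔ h24 hstd h28 hDtau'))
          (image_thetaInfty_thetaEnvData_of_rootHyp C hC hS hl hp2 hpl hζ mods f hf hmods h15 L hZ
            (piYddCharacteristic_of_cor218_i C μ hC hS h15 L R hR h218i) hlim hq μ R hR h218i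
            (rootHyp_of_cor28_i_innerAdjust C ε hq μ hC hS h15 L R hR h218i hιe hιX hΔ h24 hstd h28 hDtau')) hη)
        Γ)).IsMultiradiallyDefined := by
  haveI := hC.GtpYdd_normal
  exact prop34i_multiradiallyDefined_saturated_ofGalois C hC hS hl hp2 hpl hζ mods f hf hmods h15 L hZ
    (piYddCharacteristic_of_cor218_i C μ hC hS h15 L R hR h218i) hlim hq μ R hR h218i
    (rootHyp_of_cor28_i_innerAdjust C ε hq μ hC hS h15 L R hR h218i hιe hιX hΔ h24 hstd h28 hDtau') ι₀ τw O hO hO'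
    (hgal_of_hgalois C hO' hYcl hT hS hq μ hC h15 L R hR h218i τw hHGAL) c hlev hη Γ

/-- **The same with the coefficient datum DISCHARGED** (`exists_cyclotomeCoefficients_of_cyclotomeTower` under `hO'` + `hΔc`):
residual BY NAME {F-0620, F-0609, F-0640, `hq`, `hO'`, `hYcl`, `hT`, `hΔc`, `hιe`, `hιX`, `hΔ`, `hstd`, `hDtau'`, `hHGAL`} plus the
standing record/tower inputs (no `hcharY`, no (HCYC)). [cite: Mochizuki2012, Prop 3.4 (i) p.92] -/
theorem exists_coeff_prop34i_multiradiallyDefined_saturated_ofCor28i_innerAdjust_ofHgalois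
    (hΔc : IsCompact (D.DeltaTheta : Set D.GtpTheta))
    {η : (C.thetaEnvData μ hC hS).PiYdd → MuN p N} (hη : η ∈ (C.thetaEnvData μ hC hS).thetaCocycles)
    (Γ : Type) [Group Γ] :
    haveI := hC.GtpYdd_normal
    ∃ (c : CyclotomeCoefficients (phi C) (D.lDeltaTheta l) (PadicAlgCl p)ˣ)
      (hlev : ∀ (ζ : cyclotome (PadicAlgCl p)ˣ) (M : ℕ+),
        (((τw.modAll M).red (c.hom ζ) : MuN p M) : (PadicAlgCl p)ˣ) = (ζ : ℕ+ → (PadicAlgCl p)ˣ) M),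
      Function.Bijective c.hom ∧
      ((ex18iii (ThetaSetting.ofDoubleUnderline C μ hC hS hl hp2 hpl hζ hη) Γ).toDagger
        (TemperedThetaMonoids.prop34iRadialFunctor
          (thetaEnvTransportS C hC hS hl hp2 hpl hζ mods f hf hmods h15 L hZ
            (piYddCharacteristic_of_cor218_i C μ hC hS h15 L R hR h218i) hlim hq μ R hR h218i
            (h1LimKummerOn (phi C) (D.lDeltaTheta l) (PiYdd C) c (isOpen_stabilizer_units C)
              (finiteIndex_stabilizer_units C) O) ι₀
            (map_mrange_h1LimKummerOn_eq_of_galois C hq μ τw c hlev O hO hC hS h15 L R hR h218i hO'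
              (hgal_of_hgalois C hO' hYcl hT hS hq μ hC h15 L R hR h218i τw hHGAL))
            (image_toLim_theta_thetaEnvData_of_rootHyp C hC hS hl hp2 hpl hζ mods f hf hmods h15 L hZ
              (piYddCharacteristic_of_cor218_i C μ hC hS h15 L R hR h218i) hlim hq μ R hR h218i
              (rootHyp_of_cor28_i_innerAdjust C ε hq μ hC hS h15 L R hR h218i hιe hιX hΔ h24 hstd h28 hDtau'))
            (image_thetaInfty_thetaEnvData_of_rootHyp C hC hS hl hp2 hpl hζ mods f hf hmods h15 L hZ
              (piYddCharacteristic_of_cor218_i C μ hC hS h15 L R hR h218i) hlim hq μ R hR h218i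
              (rootHyp_of_cor28_i_innerAdjust C ε hq μ hC hS h15 L R hR h218i hιe hιX hΔ h24 hstd h28 hDtau')) hη)
          Γ)).IsMultiradiallyDefined := by
  haveI := hC.GtpYdd_normal
  exact exists_coeff_prop34i_multiradiallyDefined_saturated_ofGalois C hC hS hl hp2 hpl hζ mods f hf hmods h15 L hZ
    (piYddCharacteristic_of_cor218_i C μ hC hS h15 L R hR h218i) hlim hq μ R hR h218i
    (rootHyp_of_cor28_i_innerAdjust C ε hq μ hC hS h15 L R hR h218i hιe hιX hΔ h24 hstd h28 hDtau') ι₀ τw O hO hO'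
    (hgal_of_hgalois C hO' hYcl hT hS hq μ hC h15 L R hR h218i τw hHGAL) hΔc hη Γ

/-! ### Route 2, stable-of-Δ (`hInd` from `hιX` + `hΔ`): (P3) := (HGAL) alone -/

/-- **[IUTchII] Prop 3.4 (i) — MULTIRADIALITY OF SPLIT THETA MONOIDS AT THE GENUINE FUNCTOR, Route 2 stable-of-Δ, (P3) = (HGAL)
alone**: abc-iut-w6-d002's `prop34i_multiradiallyDefined_saturated_ofCor28iStableOfDelta` (p451697: the companion-free statement
with `hInd` DISCHARGED from `hιX` + `hΔ`) with `hgal := hgal_of_hgalois … hHGAL`. [cite: Mochizuki2012, Prop 3.4 (i) p.92] -/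
theorem prop34i_multiradiallyDefined_saturated_ofCor28iStableOfDelta_ofHgalois
    (c : CyclotomeCoefficients (phi C) (D.lDeltaTheta l) (PadicAlgCl p)ˣ)
    (hlev : ∀ (ζ : cyclotome (PadicAlgCl p)ˣ) (M : ℕ+),
      (((τw.modAll M).red (c.hom ζ) : MuN p M) : (PadicAlgCl p)ˣ) = (ζ : ℕ+ → (PadicAlgCl p)ˣ) M)
    {η : (C.thetaEnvData μ hC hS).PiYdd → MuN p N} (hη : η ∈ (C.thetaEnvData μ hC hS).thetaCocycles)
    (Γ : Type) [Group Γ] :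
    haveI := hC.GtpYdd_normal
    ((ex18iii (ThetaSetting.ofDoubleUnderline C μ hC hS hl hp2 hpl hζ hη) Γ).toDagger
      (TemperedThetaMonoids.prop34iRadialFunctor
        (thetaEnvTransportS C hC hS hl hp2 hpl hζ mods f hf hmods h15 L hZ
          (piYddCharacteristic_of_cor218_i C μ hC hS h15 L R hR h218i) hlim hq μ R hR h218i
          (h1LimKummerOn (phi C) (D.lDeltaTheta l) (PiYdd C) c (isOpen_stabilizer_units C)
            (finiteIndex_stabilizer_units C) O) ι₀
          (map_mrange_h1LimKummerOn_eq_of_galois C hq μ τw c hlev O hO hC hS h15 L R hR h218i hO'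
            (hgal_of_hgalois C hO' hYcl hT hS hq μ hC h15 L R hR h218i τw hHGAL))
          (image_toLim_theta_thetaEnvData_of_rootHyp C hC hS hl hp2 hpl hζ mods f hf hmods h15 L hZ
            (piYddCharacteristic_of_cor218_i C μ hC hS h15 L R hR h218i) hlim hq μ R hR h218i
            (fun α => rootHyp_of_cor28_i_innerAdjust_of_deltaPreserving C hq α ε μ hC hS h15 L R hR h218i hιe hιX hΔ
              h24 hstd h28 hDtau'))
          (image_thetaInfty_thetaEnvData_of_rootHyp C hC hS hl hp2 hpl hζ mods f hf hmods h15 L hZ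
            (piYddCharacteristic_of_cor218_i C μ hC hS h15 L R hR h218i) hlim hq μ R hR h218i
            (fun α => rootHyp_of_cor28_i_innerAdjust_of_deltaPreserving C hq α ε μ hC hS h15 L R hR h218i hιe hιX hΔ
              h24 hstd h28 hDtau')) hη)
        Γ)).IsMultiradiallyDefined := by
  haveI := hC.GtpYdd_normal
  exact prop34i_multiradiallyDefined_saturated_ofCor28iStableOfDelta C hC hS hl hp2 hpl hζ mods f hf hmods h15 L hZ hlim hq μ
    R hR h218i ε hιe h24 hstd h28 hDtau' hιX hΔ ι₀ τw O hO hO'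
    (hgal_of_hgalois C hO' hYcl hT hS hq μ hC h15 L R hR h218i τw hHGAL) c hlev hη Γ

/-- **The same with the coefficient datum DISCHARGED** (`exists_cyclotomeCoefficients_of_cyclotomeTower` under `hO'` + `hΔc`):
residual BY NAME {F-0620, F-0609, F-0640, `hq`, `hO'`, `hYcl`, `hT`, `hΔc`, `hιe`, `hιX`, `hΔ`, `hstd`, `hDtau'`, `hHGAL`} plus the
standing record/tower inputs. [cite: Mochizuki2012, Prop 3.4 (i) p.92] -/
theorem exists_coeff_prop34i_multiradiallyDefined_saturated_ofCor28iStableOfDelta_ofHgalois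
    (hΔc : IsCompact (D.DeltaTheta : Set D.GtpTheta))
    {η : (C.thetaEnvData μ hC hS).PiYdd → MuN p N} (hη : η ∈ (C.thetaEnvData μ hC hS).thetaCocycles)
    (Γ : Type) [Group Γ] :
    haveI := hC.GtpYdd_normal
    ∃ (c : CyclotomeCoefficients (phi C) (D.lDeltaTheta l) (PadicAlgCl p)ˣ)
      (hlev : ∀ (ζ : cyclotome (PadicAlgCl p)ˣ) (M : ℕ+),
        (((τw.modAll M).red (c.hom ζ) : MuN p M) : (PadicAlgCl p)ˣ) = (ζ : ℕ+ → (PadicAlgCl p)ˣ) M),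
      Function.Bijective c.hom ∧
      ((ex18iii (ThetaSetting.ofDoubleUnderline C μ hC hS hl hp2 hpl hζ hη) Γ).toDagger
        (TemperedThetaMonoids.prop34iRadialFunctor
          (thetaEnvTransportS C hC hS hl hp2 hpl hζ mods f hf hmods h15 L hZ
            (piYddCharacteristic_of_cor218_i C μ hC hS h15 L R hR h218i) hlim hq μ R hR h218i
            (h1LimKummerOn (phi C) (D.lDeltaTheta l) (PiYdd C) c (isOpen_stabilizer_units C)
              (finiteIndex_stabilizer_units C) O) ι₀
            (map_mrange_h1LimKummerOn_eq_of_galois C hq μ τw c hlev O hO hC hS h15 L R hR h218i hO'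
              (hgal_of_hgalois C hO' hYcl hT hS hq μ hC h15 L R hR h218i τw hHGAL))
            (image_toLim_theta_thetaEnvData_of_rootHyp C hC hS hl hp2 hpl hζ mods f hf hmods h15 L hZ
              (piYddCharacteristic_of_cor218_i C μ hC hS h15 L R hR h218i) hlim hq μ R hR h218i
              (fun α => rootHyp_of_cor28_i_innerAdjust_of_deltaPreserving C hq α ε μ hC hS h15 L R hR h218i hιe hιX hΔ
                h24 hstd h28 hDtau'))
            (image_thetaInfty_thetaEnvData_of_rootHyp C hC hS hl hp2 hpl hζ mods f hf hmods h15 L hZ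
              (piYddCharacteristic_of_cor218_i C μ hC hS h15 L R hR h218i) hlim hq μ R hR h218i
              (fun α => rootHyp_of_cor28_i_innerAdjust_of_deltaPreserving C hq α ε μ hC hS h15 L R hR h218i hιe hιX hΔ
                h24 hstd h28 hDtau')) hη)
          Γ)).IsMultiradiallyDefined := by
  haveI := hC.GtpYdd_normal
  exact exists_coeff_prop34i_multiradiallyDefined_saturated_ofCor28iStableOfDelta C hC hS hl hp2 hpl hζ mods f hf hmods h15 L
    hZ hlim hq μ R hR h218i ε hιe h24 hstd h28 hDtau' hιX hΔ ι₀ τw O hO hO'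
    (hgal_of_hgalois C hO' hYcl hT hS hq μ hC h15 L R hR h218i τw hHGAL) hΔc hη Γ

end EtaleLevels

end Literature.IUT.HodgeArakelov

end
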